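import Literature.Analysis.FluidPDE.OnsagerBDSVEnergy
import Literature.Analysis.FluidPDE.OnsagerBDSVEnergyTools
import Literature.Analysis.FluidPDE.OnsagerBDSVFlowJacobian
import HarnessLib

/-!
# The BDSV energy estimate: the principal term reduced to the oscillatory term (G₃ ← G₃′)

Buckmaster–De Lellis–Székelyhidi–Vicol (BDSV), *Onsager's conjecture for admissible weak
solutions*, CPAM 72 (2019) = arXiv:1701.08678, proof of Prop. 6.2, last paragraph: "recall from
[the expansion of `w_{o,i} ⊗ w_{o,i}`, §6.1.3] that
`∫|w_o|² = ∑_i ∫ tr R_{q,i} + ∫ ∑_{i,k≠0} ρ_{q,i} ∇Φ_i⁻¹ tr C_k(R̃_{q,i}) ∇Φ_i⁻ᵀ e^{iλ_{q+1}k·Φ_i}`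
and thus it remains to bound the second term", which is then shown to be
`≲ δ_{q+1} δ_q^{1/2} λ_q/λ_{q+1}` by the stationary-phase estimate (C.1). The named fact G₃
`BDSV.energy_principalTerm` of `OnsagerBDSVEnergy.lean` packages both halves. This file splits it:

* the **identity** is PROVED (`BDSV.integral_norm_sq_principalPart_eq`): for `t ∈ [0,T]`,
  `∫|w_o|² = 3ρ_q(t) + Osc(t)`, where `Osc(t) = ∫ e(t,x) dx` (`BDSV.oscTerm`) integrates the
  oscillatory integrand
  `e = ∑_i ρ_{q,i} tr(adj ∇Φ_i · [W ⊗ W - R](R̃_{q,i}, n_{q+1}Φ_i) · (adj ∇Φ_i)ᵀ)` (`BDSV.oscIntegrand`,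
  with the fluctuation `W ⊗ W - R` of the Mikado profile, `BDSV.MikadoDatum.fluct`, whose Fourier
  series in `ξ` is the printed `∑_{k≠0} C_k(R) e^{ik·ξ}`). Ingredients: at each point at most one
  cut-off is active, so `|w_o|² = ∑_i ρ_{q,i} |adj ∇Φ_i W_i|²`; `|Av|² = tr(A (v ⊗ v) Aᵀ)`;
  `adj ∇Φ_i R̃_{q,i} (adj ∇Φ_i)ᵀ = R_{q,i}/ρ_{q,i} = Id - (∑∫η²/ρ_q) R̊̄_q` because `det ∇Φ_i = 1`
  (`OnsagerBDSVFlowJacobian.lean`); `tr R̊̄_q = 0`; and `∑_i ∫ ρ_{q,i} = ρ_q` — i.e. exactly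
  "`∑_i ∫ tr R_{q,i} = 3∑_i ∫ ρ_{q,i} = 3ρ_q`";
* the **bound** becomes the named fact G₃′ `BDSV.energy_oscillatoryTerm`:
  `|Osc(t)| ≲ δ_{q+1} δ_q^{1/2} λ_q λ_{q+1}⁻¹` along the common prefix — the genuinely analytic half
  (Fourier expansion of the fluctuation, (C.1) = `BDSV.phaseIntegralBound` of
  `OnsagerBDSVStationaryPhase.lean`, the `C^N` bounds `‖e_{q,i}‖_N ≲ δ_{q+1} ℓ^{-N}` of Prop. 5.7 and
  the choice of `N`), the subject of a later file;
* and `BDSV.energy_principalTerm_of_oscillatoryTerm : energy_oscillatoryTerm → energy_principalTerm`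
  is PROVED.

## References

* T. Buckmaster, C. De Lellis, L. Székelyhidi Jr., V. Vicol, *Onsager's conjecture for admissible
  weak solutions*, Comm. Pure Appl. Math. 72 (2019) 229–274 = arXiv:1701.08678: proof of
  Prop. 6.2 (last paragraph); §6.1.3 (expansion of `w_{o,i} ⊗ w_{o,i}`); §5.1 (`W ⊗ W = R + ∑ C_k e^{ik·ξ}`);
  §5.2 (`ρ_{q,i}`, `R_{q,i}`); App. C (C.1).
-/

open MeasureTheory Set
open scoped NNReal ENNReal ContDiff InnerProductSpace Matrix Matrix.Norms.Elementwise

noncomputable section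

namespace Literature.Analysis.FluidPDE

namespace BDSV

open FunctionSpaces FunctionSpaces.Torus

/-- The flat three-torus `T³ = (ℝ/ℤ)³`, local notation. -/
local notation "𝕋³" => UnitAddTorus (Fin 3)

/-- Euclidean `ℝ³`, local notation. -/
local notation "ℝ³" => EuclideanSpace ℝ (Fin 3)

/-- Real `3 × 3` matrices, local notation. -/
local notation "𝕄" => Matrix (Fin 3) (Fin 3) ℝ

/-! ## The oscillatory term -/

section Defs

/-- **The fluctuation of a Mikado profile**, `G(R, ξ) := W(R,ξ) ⊗ W(R,ξ) - R` — the zero-mean part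
of `W ⊗ W` for `R ∈ 𝒩` (Lemma 5.1: `⨍ W ⊗ W = R`), whose Fourier series in `ξ` is the printed
`∑_{k≠0} C_k(R) e^{ik·ξ}` of §5.1. [cite: BuckmasterEtAl2018, §5.1 (W ⊗ W = R + ∑_{k≠0} C_k e^{ik·ξ})] -/
def MikadoDatum.fluct {r : ℝ} (𝔚 : MikadoDatum r) (R : 𝕄) (ξ : 𝕋³) : 𝕄 :=
  Matrix.of (fun a b => 𝔚.W R ξ a * 𝔚.W R ξ b) - R

variable (P : Params) (S : Setting)

/-- **The oscillatory integrand of the energy**,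
`e(x,t) = ∑_i ρ_{q,i} tr(∇Φ_i⁻¹ [W ⊗ W - R](R̃_{q,i}, λ_{q+1}Φ_i) ∇Φ_i⁻ᵀ)` with `∇Φ_i⁻¹ = adj ∇Φ_i`
(`det ∇Φ_i = 1`) — the integrand of the "second term"
`∫ ∑_{i,k≠0} ρ_{q,i} ∇Φ_i⁻¹ tr C_k(R̃_{q,i}) ∇Φ_i⁻ᵀ e^{iλ_{q+1}k·Φ_i}` of the proof of Prop. 6.2,
before Fourier expansion of the fluctuation. [cite: BuckmasterEtAl2018, Prop. 6.2 (proof, last paragraph)] -/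
def oscIntegrand (𝔚 : MikadoDatum mikadoRadius) (η : ℕ → ℝ → 𝕋³ → ℝ) (D : ℕ → ℝ → 𝕋³ → ℝ³)
    (t : ℝ) (x : 𝕋³) : ℝ :=
  ∑ i ∈ Finset.range (cutoffCount S.T (P.τ S.q)),
    rhoI P S η i t x * Matrix.trace ((gradPhi D i t x).adjugate *
      𝔚.fluct (tildeR P S η D i t x) (P.freqNat (S.q + 1) • phiPoint D i t x) *
        ((gradPhi D i t x).adjugate)ᵀ)

/-- **The oscillatory term of the energy**, `Osc(t) = ∫_{T³} e(x,t) dx`.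
[cite: BuckmasterEtAl2018, Prop. 6.2 (proof, last paragraph)] -/
def oscTerm (𝔚 : MikadoDatum mikadoRadius) (η : ℕ → ℝ → 𝕋³ → ℝ) (D : ℕ → ℝ → 𝕋³ → ℝ³)
    (t : ℝ) : ℝ :=
  ∫ x, oscIntegrand P S 𝔚 η D t x

end Defs

/-! ## The named fact G₃′: the bound on the oscillatory term -/

section Fact

/-- **The oscillatory term of the energy is small** (BDSV, proof of Prop. 6.2, last paragraph:
with `e_{q,i} := ρ_{q,i} ∇Φ_i⁻¹ tr C_k(R̃_i) ∇Φ_i⁻ᵀ`, "use Proposition [5.7] and Lemma [5.4] to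
conclude `‖e_{q,i}‖_N ≲ δ_{q+1} ℓ^{-N}`. Next observe that at any given time at most two `e_{q,i}`
are nonvanishing. Hence use [(C.1)] in Proposition [C.2] to bound
`|∫ ∑_i ∑_{k≠0} ρ_i ∇Φ_i⁻¹ tr C_k(R̃_i) ∇Φ_i⁻ᵀ e^{iλ_{q+1}k·Φ_i} dx| ≲ ∑_{k≠0} δ_{q+1}ℓ^{-N}/(λ_{q+1}^N |k|^N)`.
As already argued several time, we can choose `N` such that
`δ_{q+1}ℓ^{-N}/λ_{q+1}^N ≤ δ_{q+1}δ_q^{1/2}λ_q/λ_{q+1}`. Assuming in addition that `N` is larger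
than `4` (so that the series is summable), we obtain the desired estimate"): along the common
prefix, `|Osc(t)| ≤ C δ_{q+1} δ_q^{1/2} λ_q λ_{q+1}⁻¹` for every `t ∈ [0,T]` (`BDSV.oscTerm`).
The stationary-phase input (C.1) is the named fact `BDSV.phaseIntegralBound`
(`OnsagerBDSVStationaryPhase.lean`). [cite: BuckmasterEtAl2018, Prop. 6.2 (proof, last paragraph) and Prop. C.2 (C.1)] -/
def energy_oscillatoryTerm : Prop :=
  StageFact fun 𝔚 P C S _ _ 𝒟 => ∀ t ∈ Icc 0 S.T,
    |oscTerm P S 𝔚 𝒟.cut.η 𝒟.D t| ≤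
      C * (amp P.β P.a P.b (S.q + 1) * Real.sqrt (amp P.β P.a P.b S.q) * freq P.a P.b S.q *
        (freq P.a P.b (S.q + 1))⁻¹)

end Fact

/-! ## Linear algebra of the identity -/

section Algebra

/-- Pythagoras for a finite family of pairwise orthogonal vectors. [folklore] -/
theorem norm_sq_sum_eq_of_inner_eq_zero {ι : Type*} (s : Finset ι) (f : ι → ℝ³)
    (h : ∀ i ∈ s, ∀ j ∈ s, i ≠ j → ⟪f i, f j⟫_ℝ = 0) :
    ‖∑ i ∈ s, f i‖ ^ 2 = ∑ i ∈ s, ‖f i‖ ^ 2 := by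
  classical
  rw [← real_inner_self_eq_norm_sq, sum_inner]
  refine Finset.sum_congr rfl fun i hi => ?_
  rw [inner_sum, Finset.sum_eq_single_of_mem i hi fun j hj hji => h i hi j hj (Ne.symm hji),
    real_inner_self_eq_norm_sq]

/-- `|Av|² = tr(A (v ⊗ v) Aᵀ)` for a `3 × 3` matrix acting on `ℝ³`. [folklore] -/
theorem norm_sq_toEuclideanLin_eq_trace (A : 𝕄) (v : ℝ³) :
    ‖Matrix.toEuclideanLin A v‖ ^ 2 =
      Matrix.trace (A * Matrix.of (fun a b => v a * v b) * Aᵀ) := by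
  have hc : ∀ i, Matrix.toEuclideanLin A v i = ∑ j, A i j * v j := fun i => rfl
  rw [EuclideanSpace.norm_sq_eq, Fin.sum_univ_three, Matrix.trace_fin_three]
  simp only [Real.norm_eq_abs, sq_abs, hc, Fin.sum_univ_three, Matrix.mul_apply,
    Matrix.transpose_apply, Matrix.of_apply]
  ring

/-- `adj G (G M Gᵀ) (adj G)ᵀ = (det G)² M`. [folklore] -/
theorem adjugate_mul_conj_mul_adjugate_transpose (G M : 𝕄) :
    G.adjugate * (G * M * Gᵀ) * G.adjugateᵀ = (G.det * G.det) • M := by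
  rw [Matrix.adjugate_transpose, ← Matrix.mul_assoc, ← Matrix.mul_assoc, Matrix.adjugate_mul,
    Matrix.mul_assoc, Matrix.mul_adjugate, Matrix.det_transpose, Matrix.smul_mul, Matrix.one_mul,
    Matrix.mul_smul, Matrix.mul_one, smul_smul]

end Algebra

/-! ## The identity `∫|w_o|² = 3ρ_q + Osc` -/

section Identity

variable {P : Params} {S : Setting} {Nbar : ℕ} {Cin C₀ c₀ : ℝ} {Cη : ℕ → ℕ → ℝ}

/-- `tr(Id - c R̊̄_q) = 3` for the trace-free glued stress. [cite: BuckmasterEtAl2018, §5.2 (tr R_{q,i} = 3ρ_{q,i})] -/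
theorem trace_one_sub_smul_ofCols (H : PerturbationHypotheses P S Nbar Cin C₀) {t : ℝ}
    (ht : t ∈ Icc 0 S.T) (x : 𝕋³) (c : ℝ) :
    Matrix.trace ((1 : 𝕄) - c • ofCols (S.Rbar t x)) = 3 := by
  have htr : ∑ i, S.Rbar t x i i = 0 := H.eulerReynolds.traceFree t ht x
  rw [Matrix.trace_sub, Matrix.trace_smul, Matrix.trace_one, Fintype.card_fin, Matrix.trace]
  simp only [Matrix.diag_apply, ofCols_apply, Nat.cast_ofNat, htr, smul_zero, sub_zero]

/-- **The pointwise identity** behind `∫|w_o|² = ∑_i∫ tr R_{q,i} + (oscillatory term)`: under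
the standing hypotheses, for `a ≥ 1` (so that `det ∇Φ_i = 1`) and wherever `ρ_q/∑∫η² ≥ 0`,
`|w_o(t,x)|² = 3 ∑_i ρ_{q,i}(t,x) + e(t,x)` (`e = BDSV.oscIntegrand`).
[cite: BuckmasterEtAl2018, §6.1.3 (expansion of w_{o,i} ⊗ w_{o,i}) and §5.2 (tr R_{q,i} = 3ρ_{q,i})] -/
theorem PerturbationData.norm_sq_principalPart_eq (H : PerturbationHypotheses P S Nbar Cin C₀)
    (𝒟 : PerturbationData P S c₀ Cη) (𝔚 : MikadoDatum mikadoRadius) (ha : 1 ≤ P.a) {t : ℝ}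
    (ht : t ∈ Icc 0 S.T) (hq : 0 ≤ rhoQ P S t / etaMass P S 𝒟.cut.η t) (x : 𝕋³) :
    ‖principalPart P S 𝔚 𝒟.cut.η 𝒟.D t x‖ ^ 2 =
      3 * ∑ i ∈ Finset.range (cutoffCount S.T (P.τ S.q)), rhoI P S 𝒟.cut.η i t x +
        oscIntegrand P S 𝔚 𝒟.cut.η 𝒟.D t x := by
  -- shorthand for the summands of `w_o`
  set u : ℕ → ℝ³ := fun i => Matrix.toEuclideanLin (gradPhi 𝒟.D i t x).adjugate
    (𝔚.W (tildeR P S 𝒟.cut.η 𝒟.D i t x) (P.freqNat (S.q + 1) • phiPoint 𝒟.D i t x)) with hu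
  have hw : principalPart P S 𝔚 𝒟.cut.η 𝒟.D t x =
      ∑ i ∈ Finset.range (cutoffCount S.T (P.τ S.q)), sqrtRhoI P S 𝒟.cut.η i t x • u i := rfl
  -- at most one cut-off is active: the summands are pairwise orthogonal
  have horth : ∀ i ∈ Finset.range (cutoffCount S.T (P.τ S.q)),
      ∀ j ∈ Finset.range (cutoffCount S.T (P.τ S.q)), i ≠ j →
        ⟪sqrtRhoI P S 𝒟.cut.η i t x • u i, sqrtRhoI P S 𝒟.cut.η j t x • u j⟫_ℝ = 0 := by
    intro i _ j _ hij
    rcases 𝒟.cut.disjoint i j hij t x with h0 | h0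
    · simp only [sqrtRhoI, h0, zero_mul, zero_smul, inner_zero_left]
    · simp only [sqrtRhoI, h0, zero_mul, zero_smul, inner_zero_right]
  -- `(ρ_{q,i}^{1/2})² = ρ_{q,i}`
  have hsq : ∀ i, sqrtRhoI P S 𝒟.cut.η i t x ^ 2 = rhoI P S 𝒟.cut.η i t x := by
    intro i
    rw [sqrtRhoI, rhoI, mul_pow, Real.sq_sqrt hq]
  -- `det ∇Φ_i = 1`
  have hdet : ∀ i, (gradPhi 𝒟.D i t x).det = 1 := fun i => 𝒟.det_gradPhi_eq_one H ha i ht x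
  rw [hw, norm_sq_sum_eq_of_inner_eq_zero _ _ horth, oscIntegrand, Finset.mul_sum,
    ← Finset.sum_add_distrib]
  refine Finset.sum_congr rfl fun i _ => ?_
  rw [norm_smul, mul_pow, Real.norm_eq_abs, sq_abs, hsq, hu, norm_sq_toEuclideanLin_eq_trace]
  -- split `W ⊗ W = R̃ + (W ⊗ W - R̃)` and use `adj∇Φ R̃ adj∇Φᵀ = Id - c R̊̄`, `tr = 3`
  set G := gradPhi 𝒟.D i t x with hG
  set Rt := tildeR P S 𝒟.cut.η 𝒟.D i t x with hRt
  set WW : 𝕄 := Matrix.of (fun a b =>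
    𝔚.W Rt (P.freqNat (S.q + 1) • phiPoint 𝒟.D i t x) a *
      𝔚.W Rt (P.freqNat (S.q + 1) • phiPoint 𝒟.D i t x) b) with hWW
  have hfl : 𝔚.fluct Rt (P.freqNat (S.q + 1) • phiPoint 𝒟.D i t x) = WW - Rt := rfl
  have hsplit : WW = Rt + (WW - Rt) := by abel
  have hconj : G.adjugate * Rt * G.adjugateᵀ =
      (1 : 𝕄) - (etaMass P S 𝒟.cut.η t / rhoQ P S t) • ofCols (S.Rbar t x) := by
    rw [hRt, tildeR, ← hG, adjugate_mul_conj_mul_adjugate_transpose, hdet, mul_one, one_smul]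
  rw [hfl]
  conv_lhs => rw [hsplit]
  rw [Matrix.mul_add, Matrix.add_mul, Matrix.trace_add, hconj, trace_one_sub_smul_ofCols H ht x]
  ring

/-- `∑_i ∫ ρ_{q,i} = ρ_q` (for `∑_j∫η_j² ≠ 0`): `ρ_{q,i} = η_i² ρ_q/∑_j∫η_j²`.
[cite: BuckmasterEtAl2018, §5.2 (∑_i ∫ ρ_{q,i} = ρ_q)] -/
theorem PerturbationData.sum_integral_rhoI (𝒟 : PerturbationData P S c₀ Cη) {t : ℝ}
    (hm : etaMass P S 𝒟.cut.η t ≠ 0) :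
    ∑ i ∈ Finset.range (cutoffCount S.T (P.τ S.q)), ∫ x, rhoI P S 𝒟.cut.η i t x = rhoQ P S t := by
  have h1 : ∀ i, ∫ x, rhoI P S 𝒟.cut.η i t x =
      (∫ x, 𝒟.cut.η i t x ^ 2) * (rhoQ P S t / etaMass P S 𝒟.cut.η t) := by
    intro i
    simp only [rhoI]
    exact integral_mul_const _ _
  simp only [h1, ← Finset.sum_mul]
  rw [show (∑ i ∈ Finset.range (cutoffCount S.T (P.τ S.q)), ∫ x, 𝒟.cut.η i t x ^ 2) =
    etaMass P S 𝒟.cut.η t from rfl]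
  field_simp

/-- **The energy of the principal part** (BDSV, proof of Prop. 6.2 with §6.1.3 and §5.2:
"`∫|w_o|² = ∑_i ∫ tr R_{q,i} + [oscillatory term]`", "`∑_i ∫ tr R_{q,i} = 3∑_i ∫ρ_{q,i} = 3ρ_q`"),
PROVED for the tree's objects: under the standing hypotheses with `c₀ > 0`, `a ≥ 1` and
`ρ_q(t) ≥ 0`, `∫_{T³} |w_o(x,t)|² dx = 3ρ_q(t) + Osc(t)` for `t ∈ [0,T]`.
[cite: BuckmasterEtAl2018, Prop. 6.2 (proof) with §6.1.3] -/
theorem PerturbationData.integral_norm_sq_principalPart_eq (H : PerturbationHypotheses P S Nbar Cin C₀)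
    (𝒟 : PerturbationData P S c₀ Cη) (𝔚 : MikadoDatum mikadoRadius) (hc₀ : 0 < c₀) (ha : 1 ≤ P.a)
    (hρ : ∀ s ∈ Icc 0 S.T, 0 < rhoQ P S s) {t : ℝ} (ht : t ∈ Icc 0 S.T) :
    ∫ x, ‖principalPart P S 𝔚 𝒟.cut.η 𝒟.D t x‖ ^ 2 = 3 * rhoQ P S t + oscTerm P S 𝔚 𝒟.cut.η 𝒟.D t := by
  have hm : 0 < etaMass P S 𝒟.cut.η t := hc₀.trans_le (𝒟.le_etaMass ht)
  have hq : 0 ≤ rhoQ P S t / etaMass P S 𝒟.cut.η t := div_nonneg (hρ t ht).le hm.le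
  have hSD : SmoothData P S 𝒟.cut.η 𝒟.D := H.toSmoothData hc₀ 𝒟 hρ
  -- integrability
  have hwo : IsSmooth (principalPart P S 𝔚 𝒟.cut.η 𝒟.D t) := (hSD.principalPart 𝔚).isSmooth_slice ht
  have hi₁ : Integrable (fun x => ‖principalPart P S 𝔚 𝒟.cut.η 𝒟.D t x‖ ^ 2) := hwo.norm_sq.integrable
  have hρi : ∀ i, Integrable (fun x => rhoI P S 𝒟.cut.η i t x) := fun i =>
    ((hSD.rhoI i).isSmooth_slice ht).integrable
  have hi₂ : Integrable (fun x => 3 * ∑ i ∈ Finset.range (cutoffCount S.T (P.τ S.q)),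
      rhoI P S 𝒟.cut.η i t x) :=
    (integrable_finsetSum _ fun i _ => hρi i).const_mul 3
  have hpt : (fun x => oscIntegrand P S 𝔚 𝒟.cut.η 𝒟.D t x) = fun x =>
      ‖principalPart P S 𝔚 𝒟.cut.η 𝒟.D t x‖ ^ 2 -
        3 * ∑ i ∈ Finset.range (cutoffCount S.T (P.τ S.q)), rhoI P S 𝒟.cut.η i t x := by
    funext x
    rw [𝒟.norm_sq_principalPart_eq H 𝔚 ha ht hq x]
    ring
  have hi₃ : Integrable (fun x => oscIntegrand P S 𝔚 𝒟.cut.η 𝒟.D t x) := by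
    rw [hpt]
    exact hi₁.sub hi₂
  -- integrate the pointwise identity
  have heq : (fun x => ‖principalPart P S 𝔚 𝒟.cut.η 𝒟.D t x‖ ^ 2) = fun x =>
      3 * ∑ i ∈ Finset.range (cutoffCount S.T (P.τ S.q)), rhoI P S 𝒟.cut.η i t x +
        oscIntegrand P S 𝔚 𝒟.cut.η 𝒟.D t x :=
    funext fun x => 𝒟.norm_sq_principalPart_eq H 𝔚 ha ht hq x
  rw [heq, integral_add hi₂ hi₃, integral_const_mul, integral_finsetSum _ fun i _ => hρi i,
    𝒟.sum_integral_rhoI hm.ne', oscTerm]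

end Identity

/-! ## G₃ from G₃′ -/

section Assembly

/-- **The principal term from the oscillatory term**: the named fact G₃
(`BDSV.energy_principalTerm`: `|∫|w_o|² - 3ρ_q| ≲ δ_{q+1} δ_q^{1/2} λ_q λ_{q+1}⁻¹`) follows from the
bound G₃′ on the oscillatory term (`BDSV.energy_oscillatoryTerm`), by the proved identity
`∫|w_o|² = 3ρ_q + Osc` (with `ρ_q > 0` along the prefix from `BDSV.stageFact_rhoQ_bounds`).
[cite: BuckmasterEtAl2018, Prop. 6.2 (proof, last paragraph)] -/
theorem energy_principalTerm_of_oscillatoryTerm (h : energy_oscillatoryTerm) :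
    energy_principalTerm := by
  have m : ∀ (𝔚 : MikadoDatum mikadoRadius) (P : Params) (C C' : ℝ) (S : Setting) (c₀ : ℝ)
      (Cη : ℕ → ℕ → ℝ) (𝒟 : PerturbationData P S c₀ Cη), 1 ≤ P.a → C ≤ C' →
      (∀ t ∈ Icc 0 S.T, |oscTerm P S 𝔚 𝒟.cut.η 𝒟.D t| ≤
        C * (amp P.β P.a P.b (S.q + 1) * Real.sqrt (amp P.β P.a P.b S.q) * freq P.a P.b S.q *
          (freq P.a P.b (S.q + 1))⁻¹)) →
      ∀ t ∈ Icc 0 S.T, |oscTerm P S 𝔚 𝒟.cut.η 𝒟.D t| ≤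
        C' * (amp P.β P.a P.b (S.q + 1) * Real.sqrt (amp P.β P.a P.b S.q) * freq P.a P.b S.q *
          (freq P.a P.b (S.q + 1))⁻¹) :=
    fun 𝔚 P C C' S c₀ Cη 𝒟 ha hCC' h t ht => (h t ht).trans
      (mul_le_mul_of_nonneg_right hCC' (mul_nonneg (mul_nonneg (mul_nonneg (amp_pos ha _).le
        (Real.sqrt_nonneg _)) (freq_pos ha _).le) (inv_nonneg.2 (freq_pos ha _).le)))
  refine (stageFact_rhoQ_bounds.and h (fun _ _ _ _ _ _ _ _ _ _ h => h) m).mono (fun C => C) ?_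
  rintro 𝔚 P C S c₀ Cη 𝒟 hc₀ - - - - ha ⟨Nbar, Cin, C₀, H⟩ ⟨hρ, hosc⟩ t ht
  have ha1 : 1 ≤ P.a := ha.le
  have hρpos : ∀ s ∈ Icc 0 S.T, 0 < rhoQ P S s := fun s hs =>
    lt_of_lt_of_le (div_pos (mul_pos (amp_pos ha1 _) (Real.rpow_pos_of_pos (freq_pos ha1 _) _))
      (by norm_num)) (hρ s hs).1
  rw [𝒟.integral_norm_sq_principalPart_eq H 𝔚 hc₀ ha1 hρpos ht, add_sub_cancel_left]
  exact hosc t ht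

end Assembly

end BDSV

end Literature.Analysis.FluidPDE
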